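/-
Copyright: the b2b-balaban T⁴-continuum CRUX team, row NE7b leaf lineage `t4-ne7b-formalise-leaf-02` (gen 136). Project licence.
-/
import Summits.QuantumFields.BalabanUV.T4Continuum.Spine.NE7b.FlatFullFormFloorTorus

/-!
# THE TREE GAUGE OF [B6] (2.121) READ ON THE `ZMod` TORUS, AND THE FLAT FULL-FORM FLOOR WITH EVERY OBJECT ON `(ℤ∕nM)^d`: the `ℤ^d`-side gauge hypothesis of
# `…FlatFullFormFloorTorus.flat_full_form_floor_torus` (`B = 0` on the periodic lift's tree bonds `treeBonds n y`, `y ∈ nℤ^d ∩ [0,nM)^d`) is EQUIVALENT to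
# the intrinsic one — `B` vanishes at every block point `(val(ȳ_i)·n + r_i)_i` (TAI's base-point convention) in direction `μ` with `r_i = 0 (i < μ)`, `r_μ + 1 < n`
# —, so the U = 1 (h2) floor is stated with NO `ℤ^d` artefact (row NE7b, node U5c; residual (R2′) family (2), letter (ℓ1); E-side junction lemma, lattice geometry)

Cell `pub-balaban`, sub-cell `t4`, spine estimate NE7b (`T4WeightBudget.RelWeightBound`; the cell's OWN estimate — NOT PRINTED in [Bałaban 1983–89],
NOT PROVED).  Crux-route work under `Spine/NE7b/` by a row leaf (`t4-ne7b-formalise-leaf-02`, gen 136) under FREEZE (0)'s crux-prover clause; [folklore]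
bookkeeping; NOTHING of Bałaban's is asserted beyond what the cited modules prove; no `def`; zero `sorry`; no `T4Continuum/Support` leaf.
Import: this lineage's `…FlatFullFormFloorTorus` (FFFT: `flat_full_form_floor_torus`, `block_eq_image_boxVec`; through it `B6Lemma24Torus` (`coarseSites`,
`pbox`), `B6BondElimination` (`treeBonds`, `mem_treeBonds`), `…TorusSquareReindexing.tcls_blockBase_add_boxVec`, `T4TermwiseTorus.tcls`, `B7Prop1Explicit.boxVec`).

WHY.  FFFT's floor takes the tree (axial) gauge (2.121) in the form its supplier `B6Lemma24Torus.lemma24_torus` states it — on the `ℤ^d`-periodic model of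
the torus: `∀ y ∈ coarseSites n N, ∀ bd ∈ treeBonds n y, B (tcls N bd.1, bd.2) = 0`.  A consumer on the `ZMod` torus (the (h2) instance's `good`
predicate in `…FullFormSineFloor(Sq)`, `…CurlOnlySineFloor(Sq)`) wants the SAME condition spelled on `(ℤ∕nM)^d`: the tree of the block with coarse corner
`ȳ : (ZMod M)^d` consists of the bonds `⟨ȳ·n + r, μ⟩` with `r ∈ [0,n)^d`, `r_i = 0` for `i < μ` and `r_μ + 1 < n` ([B6] (2.121) ∕ [B5] (1.7): the contour
`Γ_{y,x}` moves along `e_1` first, then `e_2`, …; the union over `x ∈ B(y)` is this comb).  THIS FILE proves the two spellings equivalent (§1) and restates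
the floor with the intrinsic one (§2).

WHAT IS PROVED ([folklore]; `N = n·M`, `[NeZero n] [NeZero M] [NeZero (n·M)]`):
* §1 **`treeGauge_iff_blockPoint`** (`B : (Fin d → ZMod (n·M)) × Fin d → W`, any `W` with `0`):
  `(∀ y ∈ coarseSites n N, ∀ bd ∈ treeBonds n y, B (tcls N bd.1, bd.2) = 0) ↔
   ∀ (ȳ : Fin d → ZMod M) (r : Fin d → Fin n) μ, (∀ i < μ, r i = 0) → r μ + 1 < n → B ((val(ȳ_i)·n + r_i)_i, μ) = 0`
  (→: the coarse site `n·val ȳ` and the bond `(n·val ȳ + r, μ)` are a torus coarse site ∕ one of its tree bonds, `tcls_blockBase_add_boxVec`;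
  ←: a tree bond of `y ∈ nℤ^d ∩ [0,N)^d` is `y + r` (`block_eq_image_boxVec`) with `y = n·val ȳ` for `ȳ := (y∕n : ZMod M)`, the two printed conditions
  read `r_i = 0`, `r_μ + 1 < n`).
* §2 **`flat_full_form_floor_torus'`** — FFFT §3 with §1's right-hand side as the gauge hypothesis:
  `1∕(12d²)·(n^{d+1})⁻¹·Σ_c‖B c‖² ≤ n^{d−2}·Σ_j‖(n^{d+1})⁻¹ • Σ_{rt} B (ιA j rt)‖² + Σ_P‖B (ι P 0) + B (ι P 1) − B (ι P 2) − B (ι P 3)‖²`.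
* §3 toy: `d = 2`, `n = M = 1`, `B = 0` — §1's right-hand side inhabited trivially, §2 elaborates (junction by elaboration).

NOT HERE (honest): the same as FFFT — (cov) ∕ (pert) ∕ (iso) by value, the operator currency, (A3), `k > 1`; anything of Bałaban's beyond [B6] Lemma 2.4 as
PROVED in the tree.  BY-NAME EFFECT ON THE WALL: NONE.  NE7b NOT PRINTED ∕ NOT PROVED; spine PROVED 0∕9; rung (B)+1 on ONE finite T⁴ — NOT infinite volume,
NOT the mass gap, NOT Clay.
HONEST DEPENDENCY: continuum YM on T⁴ ⇐ BetaPertH ∧ nine spine estimates (0/9 proved); BetaPertH ⇐ (D1) ∧ (D4) ∧ CAP+tail; G-an2-4 gates asym, D1 and NE2/3/4.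
-/

set_option autoImplicit false

noncomputable section

open Finset
open Literature.MathematicalPhysics.QuantumFieldTheory.Balaban1983to89.B7Prop1Explicit (boxVec)
open Literature.MathematicalPhysics.QuantumFieldTheory.Balaban1983to89.T4TermwiseTorus (tcls)
open Literature.MathematicalPhysics.QuantumFieldTheory.Balaban1983to89.B6BondElimination (treeBonds mem_treeBonds)
open Literature.MathematicalPhysics.QuantumFieldTheory.Balaban1983to89.B6Lemma24Torus (pbox mem_pbox coarseSites mem_coarseSites)
open Summit.QuantumFields.BalabanUV.T4Continuum.NE7b.TorusSquareReindexing (tcls_blockBase_add_boxVec)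
open Summit.QuantumFields.BalabanUV.T4Continuum.NE7b.FlatFullFormFloorTorus (block_eq_image_boxVec flat_full_form_floor_torus)

namespace Summit.QuantumFields.BalabanUV.T4Continuum.NE7b.FlatFullFormFloorTorusGauge

variable {d : ℕ}

/-! ## §1 The tree gauge read on the `ZMod` torus: block points `n·val(ȳ) + r`, tree bonds `r_i = 0 (i < μ)`, `r_μ + 1 < n` -/

section TreeGauge

variable {W : Type*}

/-- **THE TREE GAUGE IN THE TORUS's OWN COORDINATES** — the `ℤ^d`-side hypothesis of §3 (`B = 0` on the lift's tree bonds `treeBonds n y`, `y ∈ nℤ^d ∩ [0,nM)^d`)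
is EQUIVALENT to the intrinsic one: at every block point `(val(ȳ_i)·n + r_i)_i` (TAI's base-point convention, `ȳ : (ZMod M)^d`, `r : [0,n)^d`) and direction
`μ` with `r_i = 0` for `i < μ` and `r_μ + 1 < n` — the bonds of the axial tree (2.121) of the block `B(ȳ)` — the field vanishes. [folklore] -/
theorem treeGauge_iff_blockPoint (n M : ℕ) [NeZero n] [NeZero M] [NeZero (n * M)] (B : (Fin d → ZMod (n * M)) × Fin d → W) [Zero W] :
    (∀ y ∈ coarseSites n (fun _ : Fin d => n * M), ∀ bd ∈ treeBonds n y, B (tcls (n * M) bd.1, bd.2) = 0) ↔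
      ∀ (y : Fin d → ZMod M) (r : Fin d → Fin n) (μ : Fin d), (∀ i, i < μ → r i = 0) → (r μ : ℕ) + 1 < n →
        B ((fun i => ((((y i).val * n + (r i : ℕ) : ℕ)) : ZMod (n * M))), μ) = 0 := by
  classical
  have hn : 0 < n := Nat.pos_of_ne_zero (NeZero.ne n)
  have hn' : (0 : ℤ) < n := by exact_mod_cast hn
  -- the coarse site of `ȳ` and its membership
  have hcs : ∀ y : Fin d → ZMod M, (fun i => (n : ℤ) * ((y i).val : ℤ)) ∈ coarseSites n (fun _ : Fin d => n * M) := by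
    intro y
    rw [mem_coarseSites, mem_pbox]
    refine ⟨fun i => ⟨by positivity, ?_⟩, fun i => ⟨((y i).val : ℤ), rfl⟩⟩
    have h1 : ((y i).val : ℤ) < M := by exact_mod_cast ZMod.val_lt (y i)
    push_cast
    nlinarith
  constructor
  · intro h y r μ hlt hμ
    have hb : ((fun i => (n : ℤ) * ((y i).val : ℤ)) + boxVec n r, μ) ∈ treeBonds n (fun i => (n : ℤ) * ((y i).val : ℤ)) := by
      rw [mem_treeBonds]
      refine ⟨?_, fun i hi => ?_, ?_⟩
      · rw [block_eq_image_boxVec]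
        exact mem_image.2 ⟨r, mem_univ _, rfl⟩
      · simp only [Pi.add_apply, boxVec, hlt i hi, Fin.val_zero, Nat.cast_zero, add_zero]
      · have : ((r μ : ℕ) : ℤ) + 1 < n := by exact_mod_cast hμ
        simp only [Pi.add_apply, boxVec]
        linarith
    have := h _ (hcs y) _ hb
    rwa [tcls_blockBase_add_boxVec] at this
  · intro h Y hY bd hbd
    obtain ⟨hYbox, hYdvd⟩ := mem_coarseSites.1 hY
    obtain ⟨hblk, htree, htop⟩ := mem_treeBonds.1 hbd
    -- `bd.1 = Y + r`, `Y = n·val(ȳ)`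
    rw [block_eq_image_boxVec] at hblk
    obtain ⟨r, -, hr⟩ := mem_image.1 hblk
    have hq : ∀ i, ∃ q : ℕ, q < M ∧ Y i = (n : ℤ) * (q : ℤ) := by
      intro i
      obtain ⟨q, hq⟩ := hYdvd i
      obtain ⟨h0, hlt⟩ := (mem_pbox.1 hYbox) i
      rw [hq] at h0 hlt
      have hq0 : 0 ≤ q := by nlinarith
      have hqM : q < M := by push_cast at hlt; nlinarith
      exact ⟨q.toNat, by omega, by rw [Int.toNat_of_nonneg hq0]; exact hq⟩
    choose q hqM hYq using hq
    have hYeq : Y = fun i => (n : ℤ) * ((((q i : ℕ) : ZMod M)).val : ℤ) := by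
      funext i
      rw [ZMod.val_natCast_of_lt (hqM i), hYq]
    have key := h (fun i => ((q i : ℕ) : ZMod M)) r bd.2 (fun i hi => ?_) ?_
    · rw [← hr, hYeq, tcls_blockBase_add_boxVec n (fun i => ((q i : ℕ) : ZMod M)) r]
      exact key
    · have h1 := htree i hi
      rw [← hr, Pi.add_apply] at h1
      have h2 : ((r i : ℕ) : ℤ) = 0 := by simp only [boxVec] at h1; linarith
      exact Fin.ext (by rw [Fin.val_zero]; exact_mod_cast h2)
    · have h1 := htop
      rw [← hr, Pi.add_apply] at h1
      simp only [boxVec] at h1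
      exact_mod_cast (by linarith : ((r bd.2 : ℕ) : ℤ) + 1 < n)

end TreeGauge

section FloorIntrinsic

variable {W : Type*} [NormedAddCommGroup W] [InnerProductSpace ℝ W] [FiniteDimensional ℝ W]

/-! ## §2 The flat full-form floor with the intrinsic tree gauge -/

/-- **THE FLAT FULL-FORM FLOOR, TREE GAUGE IN THE TORUS's OWN COORDINATES**: FFFT §3 with the hypothesis of `treeGauge_iff_blockPoint`'s right-hand side —
every object now lives on `(ℤ∕nM)^d`. [folklore] -/
theorem flat_full_form_floor_torus' (hd : 2 ≤ d) (n M : ℕ) [NeZero n] [NeZero M] [NeZero (n * M)]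
    (ι : (Fin d → ZMod (n * M)) × {a : Fin d × Fin d // a.1 < a.2} → Fin 4 → (Fin d → ZMod (n * M)) × Fin d)
    (hι : ∀ x a, ι (x, a) = ![(x, a.1.1), (x + Pi.single a.1.1 1, a.1.2), (x + Pi.single a.1.2 1, a.1.1), (x, a.1.2)])
    (ιA : (Fin d → ZMod M) × Fin d → (Fin d → Fin n) × Fin n → (Fin d → ZMod (n * M)) × Fin d)
    (hιA : ∀ y κ r t, ιA (y, κ) (r, t) =
      ((fun i => (((y i).val * n + (r i : ℕ) : ℕ) : ZMod (n * M))) + Pi.single κ ((t : ℕ) : ZMod (n * M)), κ))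
    (B : (Fin d → ZMod (n * M)) × Fin d → W)
    (hT : ∀ (y : Fin d → ZMod M) (r : Fin d → Fin n) (μ : Fin d), (∀ i, i < μ → r i = 0) → (r μ : ℕ) + 1 < n →
      B ((fun i => ((((y i).val * n + (r i : ℕ) : ℕ)) : ZMod (n * M))), μ) = 0) :
    1 / (12 * (d : ℝ) ^ 2) * ((n : ℝ) ^ (d + 1))⁻¹ * ∑ c, ‖B c‖ ^ 2 ≤
      (n : ℝ) ^ (d - 2) * ∑ j, ‖((n : ℝ) ^ (d + 1))⁻¹ • ∑ rt, B (ιA j rt)‖ ^ 2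
        + ∑ P, ‖B (ι P 0) + B (ι P 1) - B (ι P 2) - B (ι P 3)‖ ^ 2 :=
  flat_full_form_floor_torus hd n M ι hι ιA hιA B ((treeGauge_iff_blockPoint n M B).2 hT)

end FloorIntrinsic

/-! ## §3 Toy: `d = 2`, `n = M = 1`, the zero field -/

/- The intrinsic tree gauge of the zero field holds by `rfl`; §2 elaborates on the one-point two-scale torus with the lambda incidences (junction by
elaboration; no `ZMod` arithmetic is computed). -/
example : 1 / (12 * ((2 : ℕ) : ℝ) ^ 2) * (((1 : ℕ) : ℝ) ^ (2 + 1))⁻¹ *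
      ∑ c : (Fin 2 → ZMod (1 * 1)) × Fin 2, ‖(fun _ : (Fin 2 → ZMod (1 * 1)) × Fin 2 => (0 : EuclideanSpace ℝ (Fin 2))) c‖ ^ 2 ≤
    ((1 : ℕ) : ℝ) ^ (2 - 2) *
        ∑ j : (Fin 2 → ZMod 1) × Fin 2, ‖(((1 : ℕ) : ℝ) ^ (2 + 1))⁻¹ •
          ∑ rt : (Fin 2 → Fin 1) × Fin 1, (fun _ : (Fin 2 → ZMod (1 * 1)) × Fin 2 => (0 : EuclideanSpace ℝ (Fin 2)))
            ((fun (j : (Fin 2 → ZMod 1) × Fin 2) (rt : (Fin 2 → Fin 1) × Fin 1) =>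
              ((fun i => (((j.1 i).val * 1 + (rt.1 i : ℕ) : ℕ) : ZMod (1 * 1))) + Pi.single j.2 ((rt.2 : ℕ) : ZMod (1 * 1)), j.2)) j rt)‖ ^ 2 +
      ∑ P : (Fin 2 → ZMod (1 * 1)) × {a : Fin 2 × Fin 2 // a.1 < a.2},
        ‖(fun _ : (Fin 2 → ZMod (1 * 1)) × Fin 2 => (0 : EuclideanSpace ℝ (Fin 2)))
            ((fun (q : (Fin 2 → ZMod (1 * 1)) × {a : Fin 2 × Fin 2 // a.1 < a.2}) =>
              ![(q.1, q.2.1.1), (q.1 + Pi.single q.2.1.1 1, q.2.1.2), (q.1 + Pi.single q.2.1.2 1, q.2.1.1), (q.1, q.2.1.2)]) P 0)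
          + (fun _ : (Fin 2 → ZMod (1 * 1)) × Fin 2 => (0 : EuclideanSpace ℝ (Fin 2)))
            ((fun (q : (Fin 2 → ZMod (1 * 1)) × {a : Fin 2 × Fin 2 // a.1 < a.2}) =>
              ![(q.1, q.2.1.1), (q.1 + Pi.single q.2.1.1 1, q.2.1.2), (q.1 + Pi.single q.2.1.2 1, q.2.1.1), (q.1, q.2.1.2)]) P 1)
          - (fun _ : (Fin 2 → ZMod (1 * 1)) × Fin 2 => (0 : EuclideanSpace ℝ (Fin 2)))
            ((fun (q : (Fin 2 → ZMod (1 * 1)) × {a : Fin 2 × Fin 2 // a.1 < a.2}) =>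
              ![(q.1, q.2.1.1), (q.1 + Pi.single q.2.1.1 1, q.2.1.2), (q.1 + Pi.single q.2.1.2 1, q.2.1.1), (q.1, q.2.1.2)]) P 2)
          - (fun _ : (Fin 2 → ZMod (1 * 1)) × Fin 2 => (0 : EuclideanSpace ℝ (Fin 2)))
            ((fun (q : (Fin 2 → ZMod (1 * 1)) × {a : Fin 2 × Fin 2 // a.1 < a.2}) =>
              ![(q.1, q.2.1.1), (q.1 + Pi.single q.2.1.1 1, q.2.1.2), (q.1 + Pi.single q.2.1.2 1, q.2.1.1), (q.1, q.2.1.2)]) P 3)‖ ^ 2 := by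
  haveI : NeZero (1 * 1) := ⟨by norm_num⟩
  exact flat_full_form_floor_torus' (W := EuclideanSpace ℝ (Fin 2)) le_rfl 1 1
    (fun q => ![(q.1, q.2.1.1), (q.1 + Pi.single q.2.1.1 1, q.2.1.2), (q.1 + Pi.single q.2.1.2 1, q.2.1.1), (q.1, q.2.1.2)])
    (fun _ _ => rfl)
    (fun j rt => ((fun i => (((j.1 i).val * 1 + (rt.1 i : ℕ) : ℕ) : ZMod (1 * 1))) + Pi.single j.2 ((rt.2 : ℕ) : ZMod (1 * 1)), j.2))
    (fun _ _ _ _ => rfl) (fun _ => 0) (fun _ _ _ _ _ => rfl)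

end Summit.QuantumFields.BalabanUV.T4Continuum.NE7b.FlatFullFormFloorTorusGauge

end
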